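import Summits.HodgeConjecture.HodgeConjecture.Theses.SaitoKurokawaBridge
import Literature.AlgebraicGeometry.HodgeTheory.ComplexOrientationFamily

/-!
# Birth skeleton — piece `SaitoKurokawaCoverPeriodsVanish` (decomposition of `ExtremeBridgeFailure`)

Two registered stubs and the kernel-checked composition
`SaitoKurokawaCoverPeriodsVanish_of : stub_gysinTransfer → stub_transportedClassOrthogonal → SaitoKurokawaCoverPeriodsVanish`.

* `stub_gysinTransfer` (TRUE — and PROVED in `GysinTransfer.lean` of this crux dir,
  `stub_gysinTransfer_proof`, via `complexGysin_injective_top`; kept registered here as the line's first step): for a dominant `p : W ⟶ M.Z`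
  between smooth projective `17`-folds the Gysin morphism `p_* : H³⁴(W) → H³⁴(M.Z)` is injective
  (`deg p ≠ 0`), and `p_*(p^*a ∪ q^*b) = a ∪ p_* q^* b` (projection formula `complexGysin_cup`); hence
  the period on `W` vanishes as soon as the TRANSPORTED class `p_* q^* b ∈ H^{0,17}(M.Z)` is orthogonal
  to `a`.
* `stub_transportedClassOrthogonal` (the core, TRANSFER form `C⁺` of the piece): on the FIXED variety
  `M.Z`, every class `p_* q^* b` transported from `N.Z` through a dominant smooth common cover is
  orthogonal to the invariant `(17,0)`-class `a` (`= ω(f₁₈)`): `a ∪ p_* q^* b = 0` in `H³⁴(M.Z(ℂ))`.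
  Why easier: the unknown now lives in ONE finite-dimensional space `H¹⁷(M.Z)` and, after averaging over
  `M.G`, in `Hom_{ℚ-HS}(H¹⁷(N.Z)^{N.G}, H¹⁷(M̄_{1,17}) ⊇ s₁₈)`: the claim is that the ALGEBRAICALLY INDUCED
  part of this Hom-space has zero `s₁₈`-component — a statement about the Lefschetz/Mumford–Tate side of
  two explicit rank-2-isotypic Hodge structures, where semisimplicity, Hecke-equivariance of modular
  correspondences and Ichino–Ikeda period formulas apply.
-/

set_option linter.dupNamespace false

open CategoryTheory MonoidalCategory AlgebraicGeometry
open Literature.AlgebraicGeometry Literature.AlgebraicGeometry.HodgeTheory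
open Literature.AlgebraicTopology.SingularHomology


namespace Summit.HodgeConjecture.HodgeConjecture.Cruxes.ExtremeBridgeFailure.CoverPeriods

open Summit.HodgeConjecture.HodgeConjecture.Theses.SaitoKurokawaBridge
open CartesianMonoidalCategory SemiCartesianMonoidalCategory

/-- LOCAL COPY (verbatim statement) of the route decl `SaitoKurokawaCoverPeriodsVanish` (item
stmt-HodgeConjecture-18127, route rev ≥ 12), under a distinct name so that the skeleton elaborates whether
or not the farm already serves the refreshed route module; definitionally the same `Prop`, so
`SaitoKurokawaCoverPeriodsVanish_of` below transports to the route decl by `fun h ↦ h`. -/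
def CoverPeriodsVanishPiece : Prop :=
  ∀ (M : Literature.AlgebraicGeometry.ModuliOfCurves.StableCurvesModuliCover ℂ 1 17) (N : Literature.AlgebraicGeometry.ModuliOfCurves.StableCurvesModuliCover ℂ 2 14) (a : Literature.AlgebraicGeometry.HodgeTheory.complexBetti M.Z 17) (b : Literature.AlgebraicGeometry.HodgeTheory.complexBetti N.Z 17), (∀ g : M.G, Literature.AlgebraicGeometry.HodgeTheory.complexBetti.map (M.act g).hom 17 a = a) → Literature.AlgebraicGeometry.HodgeTheory.IsOfHodgeType 17 M.Z 17 17 0 a → (∀ g : N.G, Literature.AlgebraicGeometry.HodgeTheory.complexBetti.map (N.act g).hom 17 b = b) → Literature.AlgebraicGeometry.HodgeTheory.IsOfHodgeType 17 N.Z 17 0 17 b → ∀ (W : Literature.AlgebraicGeometry.Motives.SchemeOver ℂ) (_ : Literature.AlgebraicGeometry.Motives.IsSmoothProjective 17 W) (p : W ⟶ M.Z) (q : W ⟶ N.Z), closure (Set.range p.left.base) = Set.univ → closure (Set.range q.left.base) = Set.univ → Literature.AlgebraicTopology.SingularHomology.cupProduct (rfl : 17 + 17 = 17 + 17) (Literature.AlgebraicGeometry.HodgeTheory.complexBetti.map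 p 17 a) (Literature.AlgebraicGeometry.HodgeTheory.complexBetti.map q 17 b) = 0

/-- The Gysin morphism `p_* : H¹⁷(W(ℂ)) → H¹⁷(M.Z(ℂ))` of a morphism of smooth projective `17`-folds
(complex orientation family). -/
noncomputable abbrev transport {W Y : Motives.SchemeOver ℂ} (hW : Motives.IsSmoothProjective 17 W)
    (hY : Motives.IsSmoothProjective 17 Y) (p : W ⟶ Y) :
    complexBetti W 17 →ₗ[ℂ] complexBetti Y 17 :=
  complexGysin complexOrientationFamily hW hY p (rfl : 17 + 2 * 17 = 17 + 2 * 17)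

/-- STUB 1 (true, M-sized): **Gysin transfer of the period to `M.Z`.** If the transported class
`p_* q^* b` is orthogonal to `a` on `M.Z`, the period `p^*a ∪ q^*b` on the dominant cover `W` vanishes
(`p_*(p^*a ∪ q^*b) = a ∪ p_* q^* b` by the projection formula, and `p_*` is injective on `H³⁴` of the
`17`-fold `W` because `deg p ≠ 0` for a dominant morphism of `17`-folds). -/
theorem stub_gysinTransfer :
    ∀ (M : Literature.AlgebraicGeometry.ModuliOfCurves.StableCurvesModuliCover ℂ 1 17)
      (N : Literature.AlgebraicGeometry.ModuliOfCurves.StableCurvesModuliCover ℂ 2 14)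
      (a : complexBetti M.Z 17) (b : complexBetti N.Z 17)
      (W : Motives.SchemeOver ℂ) (hW : Motives.IsSmoothProjective 17 W) (p : W ⟶ M.Z) (q : W ⟶ N.Z),
      closure (Set.range p.left.base) = Set.univ →
      cupProduct (rfl : 17 + 17 = 17 + 17) a
          (transport hW (M.isSmoothProjective : Motives.IsSmoothProjective 17 M.Z) p
            (complexBetti.map q 17 b)) = 0 →
      cupProduct (rfl : 17 + 17 = 17 + 17) (complexBetti.map p 17 a) (complexBetti.map q 17 b) = 0 := by
  sorry

/-- STUB 2 (core, transfer form `C⁺`): **transported classes are orthogonal to `ω(f₁₈)`.** For all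
covers, all invariant `a` of type `(17,0)` and `b` of type `(0,17)`, and every dominant smooth common
cover `(W, p, q)`: `a ∪ p_* q^* b = 0` in `H³⁴(M.Z(ℂ); ℂ)`. -/
theorem stub_transportedClassOrthogonal :
    ∀ (M : Literature.AlgebraicGeometry.ModuliOfCurves.StableCurvesModuliCover ℂ 1 17)
      (N : Literature.AlgebraicGeometry.ModuliOfCurves.StableCurvesModuliCover ℂ 2 14)
      (a : complexBetti M.Z 17) (b : complexBetti N.Z 17),
      (∀ g : M.G, complexBetti.map (M.act g).hom 17 a = a) → IsOfHodgeType 17 M.Z 17 17 0 a →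
      (∀ g : N.G, complexBetti.map (N.act g).hom 17 b = b) → IsOfHodgeType 17 N.Z 17 0 17 b →
      ∀ (W : Motives.SchemeOver ℂ) (hW : Motives.IsSmoothProjective 17 W) (p : W ⟶ M.Z) (q : W ⟶ N.Z),
        closure (Set.range p.left.base) = Set.univ → closure (Set.range q.left.base) = Set.univ →
        cupProduct (rfl : 17 + 17 = 17 + 17) a
          (transport hW (M.isSmoothProjective : Motives.IsSmoothProjective 17 M.Z) p
            (complexBetti.map q 17 b)) = 0 := by
  sorry

/-- COMPOSITION (kernel-checked, no sorry of its own): the two stubs give the piece BY NAME. -/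
theorem SaitoKurokawaCoverPeriodsVanish_of
    (h1 : ∀ (M : Literature.AlgebraicGeometry.ModuliOfCurves.StableCurvesModuliCover ℂ 1 17)
      (N : Literature.AlgebraicGeometry.ModuliOfCurves.StableCurvesModuliCover ℂ 2 14)
      (a : complexBetti M.Z 17) (b : complexBetti N.Z 17)
      (W : Motives.SchemeOver ℂ) (hW : Motives.IsSmoothProjective 17 W) (p : W ⟶ M.Z) (q : W ⟶ N.Z),
      closure (Set.range p.left.base) = Set.univ →
      cupProduct (rfl : 17 + 17 = 17 + 17) a
          (transport hW (M.isSmoothProjective : Motives.IsSmoothProjective 17 M.Z) p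
            (complexBetti.map q 17 b)) = 0 →
      cupProduct (rfl : 17 + 17 = 17 + 17) (complexBetti.map p 17 a) (complexBetti.map q 17 b) = 0)
    (h2 : ∀ (M : Literature.AlgebraicGeometry.ModuliOfCurves.StableCurvesModuliCover ℂ 1 17)
      (N : Literature.AlgebraicGeometry.ModuliOfCurves.StableCurvesModuliCover ℂ 2 14)
      (a : complexBetti M.Z 17) (b : complexBetti N.Z 17),
      (∀ g : M.G, complexBetti.map (M.act g).hom 17 a = a) → IsOfHodgeType 17 M.Z 17 17 0 a →
      (∀ g : N.G, complexBetti.map (N.act g).hom 17 b = b) → IsOfHodgeType 17 N.Z 17 0 17 b →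
      ∀ (W : Motives.SchemeOver ℂ) (hW : Motives.IsSmoothProjective 17 W) (p : W ⟶ M.Z) (q : W ⟶ N.Z),
        closure (Set.range p.left.base) = Set.univ → closure (Set.range q.left.base) = Set.univ →
        cupProduct (rfl : 17 + 17 = 17 + 17) a
          (transport hW (M.isSmoothProjective : Motives.IsSmoothProjective 17 M.Z) p
            (complexBetti.map q 17 b)) = 0) :
    CoverPeriodsVanishPiece :=
  fun M N a b haG ha hbG hb W hW p q hp hq ↦
    h1 M N a b W hW p q hp (h2 M N a b haG ha hbG hb W hW p q hp hq)

end Summit.HodgeConjecture.HodgeConjecture.Cruxes.ExtremeBridgeFailure.CoverPeriods
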